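import Literature.Analysis.SpecialFunctions.QRogersSum

/-!
# The factorial form of Rogers' `₆φ₅` sum (the norm of an extremal column of a `q`-Racah matrix)

In symmetric quantum numbers `[m]` and `[n]! = [1]⋯[n]` (`qBr`, `qFac`), for natural numbers `g, δ, n, ε` put
`μ = g + δ`, `e = n + ε`, `B = μ + 1 + e`. Then

  `Σ_{y=0}^{n} [2y+μ+1] [y+B]! [y+μ]! [y+g]! [e-y]! / ([y+μ+1+n]! [y]! [y+δ]! [n-y]!)
        = [B]! [g]! [e+g+1]! [ε]! / ([n]! [ε+g+1]! [δ+n]!)`                                   (`vwp_factorial_sum`)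

whenever `[m] ≠ 0` for `1 ≤ m ≤ B + n`. Indeed the summand is `C · t_n(y)` for the very-well-poised `₆φ₅` summand `t_n`
of `QRogersSum.lean` with `α = μ+1, β = B+1, γ = g+1` (`vwpTerm_eq`), and the right side is `C` times Rogers' closed
form (`rogers_sum`); the conversion uses `⟨u+1⟩_y [u]! = [u+y]!` and `⟨-e⟩_y [e-y]! = (-1)^y [e]!`. This is the shape
of `Σ_i ṽ_i S_{ij₀}²` for the extremal column `j₀ = a - b` of the Kauffman–Lins Racah matrix
(`RepresentationTheory/ModularTensorCategories/KLRacahNorm.lean`). No named facts.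

## References

* G. Gasper, M. Rahman, *Basic Hypergeometric Series* (2004), §2.4 eq. (2.4.2), §7.2. [GasperRahman2004]
-/

namespace Literature.Analysis.SpecialFunctions

open Finset

variable {K : Type*} [Field K]

/-- `[n]! ≠ 0` when `[1], …, [n] ≠ 0`. [folklore] -/
theorem qFac_ne_zero_of (p : K) {n : ℕ} (h : ∀ m : ℕ, 1 ≤ m → m ≤ n → qBr p m ≠ 0) : qFac p n ≠ 0 := by
  unfold qFac
  refine prod_ne_zero_iff.mpr fun s hs => ?_
  have := h (s + 1) (by omega) (by rw [mem_range] at hs; omega)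
  exact_mod_cast this

/-- `⟨u+1⟩_y [u]! = [u+y]!` (`u ∈ ℕ`). [folklore] -/
theorem qPoch_natSucc_mul_qFac (p : K) (u y : ℕ) : qPoch p ((u : ℤ) + 1) y * qFac p u = qFac p (u + y) := by
  induction y with
  | zero => simp
  | succ y ih =>
    rw [qPoch_succ, show u + (y + 1) = (u + y) + 1 by ring, qFac_succ, ← ih]
    push_cast
    ring_nf

/-- `⟨1⟩_y = [y]!`. [folklore] -/
theorem qPoch_one_eq_qFac (p : K) (y : ℕ) : qPoch p 1 y = qFac p y := by
  have h := qPoch_natSucc_mul_qFac p 0 y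
  simp only [Nat.cast_zero, zero_add] at h
  rw [← h]; simp [qFac]

/-- `⟨-e⟩_y [e-y]! = (-1)^y [e]!` for `y ≤ e`. [folklore] -/
theorem qPoch_neg_mul_qFac (p : K) {e y : ℕ} (h : y ≤ e) : qPoch p (-(e : ℤ)) y * qFac p (e - y) = (-1) ^ y * qFac p e := by
  induction y with
  | zero => simp
  | succ y ih =>
    have ih := ih (by omega)
    rw [qPoch_succ, pow_succ]
    have e1 : qBr p (-(e : ℤ) + (y : ℕ)) = -qBr p (((e - (y + 1) : ℕ) : ℤ) + 1) := by
      rw [← qBr_neg]; congr 1; push_cast [Nat.cast_sub h]; ring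
    have e2 : qFac p (e - y) = qFac p (e - (y + 1)) * qBr p (((e - (y + 1) : ℕ) : ℤ) + 1) := by
      rw [← qFac_succ]; congr 1; omega
    rw [e1]
    rw [e2] at ih
    linear_combination -ih

section VWP

variable (p : K) (g δ n ε : ℕ)

/-- The summand `[2y+μ+1][y+B]![y+μ]![y+g]![e-y]!/([y+μ+1+n]![y]![y+δ]![n-y]!)`, `μ = g+δ`, `e = n+ε`, `B = μ+1+e`.
[cite: GasperRahman2004, §7.2 (the weights of the q-Racah orthogonality in factorial form)] -/
def vwpTerm (y : ℕ) : K :=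
  qBr p (2 * y + (g + δ) + 1) * qFac p (y + (g + δ + 1 + (n + ε))) * qFac p (y + (g + δ)) * qFac p (y + g) *
      qFac p (n + ε - y) / (qFac p (y + (g + δ) + 1 + n) * qFac p y * qFac p (y + δ) * qFac p (n - y))

/-- The constant `C = [e]![μ]![B]![g]!/([δ]![μ+1+n]![n]!)` with `vwpTerm = C · rogersTerm`. [folklore] -/
def vwpConst : K :=
  qFac p (n + ε) * qFac p (g + δ) * qFac p (g + δ + 1 + (n + ε)) * qFac p g /
    (qFac p δ * qFac p (g + δ + 1 + n) * qFac p n)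

variable {p g δ n ε}

/-- `vwpTerm y = C · t_n(y)` with `(α, β, γ) = (μ+1, B+1, g+1)`. [cite: GasperRahman2004, §2.4 eq. (2.4.2)] -/
theorem vwpTerm_eq (hbr : ∀ m : ℕ, 1 ≤ m → m ≤ g + δ + 1 + (n + ε) + n → qBr p (m : ℤ) ≠ 0) {y : ℕ} (hy : y ≤ n) :
    vwpTerm p g δ n ε y =
      vwpConst p g δ n ε *
        rogersTerm p (((g + δ : ℕ) : ℤ) + 1) (((g + δ + 1 + (n + ε) : ℕ) : ℤ) + 1) (((g : ℕ) : ℤ) + 1) n y := by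
  have hF : ∀ m : ℕ, m ≤ g + δ + 1 + (n + ε) + n → qFac p m ≠ 0 := fun m hm =>
    qFac_ne_zero_of p fun m' h1 h2 => hbr m' h1 (by omega)
  -- Pochhammer-to-factorial conversions
  have c1 : qPoch p (((g + δ : ℕ) : ℤ) + 1) y = qFac p (g + δ + y) / qFac p (g + δ) := by
    rw [eq_div_iff (hF _ (by omega)), qPoch_natSucc_mul_qFac]
  have c2 : qPoch p (((g + δ + 1 + (n + ε) : ℕ) : ℤ) + 1) y = qFac p (g + δ + 1 + (n + ε) + y) / qFac p (g + δ + 1 + (n + ε)) := by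
    rw [eq_div_iff (hF _ (by omega)), qPoch_natSucc_mul_qFac]
  have c3 : qPoch p (((g : ℕ) : ℤ) + 1) y = qFac p (g + y) / qFac p g := by
    rw [eq_div_iff (hF _ (by omega)), qPoch_natSucc_mul_qFac]
  have c4 : qPoch p (-(n : ℤ)) y = (-1) ^ y * qFac p n / qFac p (n - y) := by
    rw [eq_div_iff (hF _ (by omega)), qPoch_neg_mul_qFac p hy]
  have c5 : qPoch p 1 y = qFac p y := qPoch_one_eq_qFac p y
  have c6 : qPoch p (((g + δ : ℕ) : ℤ) + 1 + 1 - (((g + δ + 1 + (n + ε) : ℕ) : ℤ) + 1)) y =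
      (-1) ^ y * qFac p (n + ε) / qFac p (n + ε - y) := by
    rw [show ((g + δ : ℕ) : ℤ) + 1 + 1 - (((g + δ + 1 + (n + ε) : ℕ) : ℤ) + 1) = -((n + ε : ℕ) : ℤ) by push_cast; ring,
      eq_div_iff (hF _ (by omega)), qPoch_neg_mul_qFac p (by omega : y ≤ n + ε)]
  have c7 : qPoch p (((g + δ : ℕ) : ℤ) + 1 + 1 - (((g : ℕ) : ℤ) + 1)) y = qFac p (δ + y) / qFac p δ := by
    rw [show ((g + δ : ℕ) : ℤ) + 1 + 1 - (((g : ℕ) : ℤ) + 1) = ((δ : ℕ) : ℤ) + 1 by push_cast; ring,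
      eq_div_iff (hF _ (by omega)), qPoch_natSucc_mul_qFac]
  have c8 : qPoch p (((g + δ : ℕ) : ℤ) + 1 + 1 + n) y = qFac p (g + δ + 1 + n + y) / qFac p (g + δ + 1 + n) := by
    rw [show ((g + δ : ℕ) : ℤ) + 1 + 1 + n = ((g + δ + 1 + n : ℕ) : ℤ) + 1 by push_cast; ring,
      eq_div_iff (hF _ (by omega)), qPoch_natSucc_mul_qFac]
  unfold vwpTerm vwpConst rogersTerm
  rw [c1, c2, c3, c4, c5, c6, c7, c8]
  rw [show ((g + δ : ℕ) : ℤ) + 1 + 2 * ((y : ℕ) : ℤ) = 2 * (y : ℤ) + ((g : ℤ) + (δ : ℤ)) + 1 by push_cast; ring,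
    show g + δ + y = y + (g + δ) by ring, show g + δ + 1 + (n + ε) + y = y + (g + δ + 1 + (n + ε)) by ring,
    show g + y = y + g by ring, show δ + y = y + δ by ring, show g + δ + 1 + n + y = y + (g + δ) + 1 + n by ring]
  have h1 := hF (n + ε) (by omega)
  have h2 := hF (g + δ) (by omega)
  have h3 := hF (g + δ + 1 + (n + ε)) (by omega)
  have h4 := hF g (by omega)
  have h5 := hF δ (by omega)
  have h6 := hF (g + δ + 1 + n) (by omega)
  have h7 := hF n (by omega)
  have h8 := hF (n - y) (by omega)
  have h9 := hF (n + ε - y) (by omega)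
  have h10 := hF (y + (g + δ) + 1 + n) (by omega)
  have h11 := hF y (by omega)
  have h12 := hF (y + δ) (by omega)
  have hs : ((-1 : K)) ^ y ≠ 0 := pow_ne_zero _ (neg_ne_zero.mpr one_ne_zero)
  field_simp

/-- **The factorial form of Rogers' sum**:
`Σ_{y=0}^{n} [2y+μ+1][y+B]![y+μ]![y+g]![e-y]!/([y+μ+1+n]![y]![y+δ]![n-y]!) = [B]![g]![e+g+1]![ε]!/([n]![ε+g+1]![δ+n]!)`
(`μ = g+δ`, `e = n+ε`, `B = μ+1+e`), when `[m] ≠ 0` for `1 ≤ m ≤ B + n`. [cite: GasperRahman2004, §2.4 eq. (2.4.2), §7.2] -/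
theorem vwp_factorial_sum (hp : p ≠ 0) (hbr : ∀ m : ℕ, 1 ≤ m → m ≤ g + δ + 1 + (n + ε) + n → qBr p (m : ℤ) ≠ 0) :
    ∑ y ∈ range (n + 1), vwpTerm p g δ n ε y =
      qFac p (g + δ + 1 + (n + ε)) * qFac p g * qFac p (n + ε + g + 1) * qFac p ε /
        (qFac p n * qFac p (ε + g + 1) * qFac p (δ + n)) := by
  have hF : ∀ m : ℕ, m ≤ g + δ + 1 + (n + ε) + n → qFac p m ≠ 0 := fun m hm =>
    qFac_ne_zero_of p fun m' h1 h2 => hbr m' h1 (by omega)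
  -- brackets with integer arguments in `[-(B+n), B+n] \ {0}` are non-zero
  have hbrZ : ∀ m : ℤ, m ≠ 0 → -((g + δ + 1 + (n + ε) + n : ℕ) : ℤ) ≤ m → m ≤ ((g + δ + 1 + (n + ε) + n : ℕ) : ℤ) →
      qBr p m ≠ 0 := by
    intro m hm0 hlo hhi
    rcases le_or_gt 0 m with h | h
    · obtain ⟨m', rfl⟩ := Int.eq_ofNat_of_zero_le h
      exact hbr m' (by omega) (by omega)
    · obtain ⟨m', hm'⟩ := Int.eq_ofNat_of_zero_le (by omega : 0 ≤ -m)
      rw [show m = -(m' : ℤ) by omega, qBr_neg, neg_ne_zero]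
      exact hbr m' (by omega) (by omega)
  -- Rogers' sum applies
  have hR : ∀ m : ℕ, m < n → RogersHyp p (((g + δ : ℕ) : ℤ) + 1) (((g + δ + 1 + (n + ε) : ℕ) : ℤ) + 1)
      (((g : ℕ) : ℤ) + 1) m := by
    intro m hm
    refine ⟨fun s hs => ?_, fun s hs => ?_, fun s hs => ?_, fun s hs => ?_, fun s hs => ?_⟩
    · exact_mod_cast hbr (1 + s) (by omega) (by omega)
    · apply hbrZ <;> push_cast <;> omega
    · apply hbrZ <;> push_cast <;> omega
    · apply hbrZ <;> push_cast <;> omega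
    · apply hbrZ <;> push_cast <;> omega
  have hsum := rogers_sum (α := ((g + δ : ℕ) : ℤ) + 1) (β := ((g + δ + 1 + (n + ε) : ℕ) : ℤ) + 1)
    (γ := ((g : ℕ) : ℤ) + 1) hp n hR
  rw [sum_congr rfl fun y hy => vwpTerm_eq hbr (Nat.lt_succ_iff.mp (mem_range.mp hy)), ← mul_sum]
  unfold rogersSum at hsum
  rw [hsum]
  -- the closed form: convert the four Pochhammers of `rogersRHS` to factorials
  unfold rogersRHS vwpConst
  have d1 : qPoch p (((g + δ : ℕ) : ℤ) + 1 + 1) n = qFac p (g + δ + 1 + n) / qFac p (g + δ + 1) := by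
    rw [show ((g + δ : ℕ) : ℤ) + 1 + 1 = ((g + δ + 1 : ℕ) : ℤ) + 1 by push_cast; ring,
      eq_div_iff (hF _ (by omega)), qPoch_natSucc_mul_qFac]
  have d2 : qPoch p (((g + δ : ℕ) : ℤ) + 1 + 1 - (((g + δ + 1 + (n + ε) : ℕ) : ℤ) + 1) - (((g : ℕ) : ℤ) + 1)) n =
      (-1) ^ n * qFac p (n + ε + g + 1) / qFac p (ε + g + 1) := by
    have h0 := qPoch_neg_mul_qFac p (e := n + ε + g + 1) (y := n) (by omega)
    rw [show n + ε + g + 1 - n = ε + g + 1 by omega] at h0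
    rw [show ((g + δ : ℕ) : ℤ) + 1 + 1 - (((g + δ + 1 + (n + ε) : ℕ) : ℤ) + 1) - (((g : ℕ) : ℤ) + 1) =
        -((n + ε + g + 1 : ℕ) : ℤ) by push_cast; ring, eq_div_iff (hF _ (by omega)), h0]
  have d3 : qPoch p (((g + δ : ℕ) : ℤ) + 1 + 1 - (((g + δ + 1 + (n + ε) : ℕ) : ℤ) + 1)) n =
      (-1) ^ n * qFac p (n + ε) / qFac p ε := by
    have h0 := qPoch_neg_mul_qFac p (e := n + ε) (y := n) (by omega)
    rw [Nat.add_sub_cancel_left] at h0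
    rw [show ((g + δ : ℕ) : ℤ) + 1 + 1 - (((g + δ + 1 + (n + ε) : ℕ) : ℤ) + 1) = -((n + ε : ℕ) : ℤ) by push_cast; ring,
      eq_div_iff (hF _ (by omega)), h0]
  have d4 : qPoch p (((g + δ : ℕ) : ℤ) + 1 + 1 - (((g : ℕ) : ℤ) + 1)) n = qFac p (δ + n) / qFac p δ := by
    rw [show ((g + δ : ℕ) : ℤ) + 1 + 1 - (((g : ℕ) : ℤ) + 1) = ((δ : ℕ) : ℤ) + 1 by push_cast; ring,
      eq_div_iff (hF _ (by omega)), qPoch_natSucc_mul_qFac]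
  rw [d1, d2, d3, d4]
  have e5 : qFac p (g + δ + 1) = qFac p (g + δ) * qBr p (((g + δ : ℕ) : ℤ) + 1) := qFac_succ p (g + δ)
  rw [e5]
  have h1 := hF (n + ε) (by omega)
  have h2 := hF (g + δ) (by omega)
  have h3 := hF (g + δ + 1 + (n + ε)) (by omega)
  have h4 := hF g (by omega)
  have h5 := hF δ (by omega)
  have h6 := hF (g + δ + 1 + n) (by omega)
  have h7 := hF n (by omega)
  have h8 := hF ε (by omega)
  have h9 := hF (ε + g + 1) (by omega)
  have h10 := hF (δ + n) (by omega)
  have h11 := hF (n + ε + g + 1) (by omega)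
  have h12 : qBr p (((g + δ : ℕ) : ℤ) + 1) ≠ 0 := by exact_mod_cast hbr (g + δ + 1) (by omega) (by omega)
  have hs : ((-1 : K)) ^ n ≠ 0 := pow_ne_zero _ (neg_ne_zero.mpr one_ne_zero)
  field_simp

end VWP

end Literature.Analysis.SpecialFunctions
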